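import Summits.CriticalPhenomena.PercolationContinuityZ3.Theorems.PercNearOneGluingNoHeavyQuantGatesWidthEight
import Summits.CriticalPhenomena.PercolationContinuityZ3.Theorems.PercNearOneGluingNoHeavyQuantWidthNineCellsA
import Summits.CriticalPhenomena.PercolationContinuityZ3.Theorems.PercNearOneGluingNoHeavyQuantWidthNineCellsB
import HarnessLib

/-!
# QUANT lane R8, T-DEC: WIDTH 9 OF THE HOEFFDING REDUCTION — conjecture BLOB-AFL for EVERY gate vector of width ≤ 9 follows from the single
# equal-gates statement "nine equal blobs are heavy at their common gate" (prim-quant-census-2 gen 83, file 15)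

builds on p205010 (kernel theorem, internal audit signed; external expert review pending)

Support file (`--supports stmt-CriticalPhenomena-4575`), QUANT lane census seat prim-quant-census-2 (gen 83); memo
`run/shared/lean/prim/quant/prim-quant-census-2-g83/HOEFFDING-G83.md` §4.  Theorems only, standard axioms, no sorries, no definitions.

All `m ≥ 1` cells of width 9 are kernel (`heavy_c27`, `heavy_c18a..e`, `…QuantWidthNineCellsA`; the two-low piece `heavy_c18f`,
`…QuantWidthNineCellsB`; the reflection cells `g ≥ 1/2`; the width-8 cells of `…QuantGatesWidthEight`).  The ONLY missing cell is `m = 0`, `r = 9`: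
nine EQUAL blobs with a common gate `g ∈ (2/9, 1/2)` (for `g ≤ 2/9` by `heavy_blobLaw_of_mean_le_two`, for `g ≥ 1/2` by reflection) — the
equal-gates BLOB-AFL at width 9, whose uniform-spreading certificate needs the three-low template (REFLECTION-G82 §0).  This file records the
implication, so that width 9 for ARBITRARY gates closes the moment that one-parameter statement lands:
* `heavy_replicate_le_nine_floor_of`, `heavy_lowCells_le_nine_floor` — the cells up to `m + r ≤ 9` (the first one modulo the nine-blob hypothesis).
* **`heavy_blobLaw_gates_width_le_nine_of_nine`** — IF `blobLaw (replicate 9 (k,g))` is heavy at `(g, 9·k·g)` for every `0 < g < 1` THEN for every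
  gate list `G ⊂ [0,1]` with `|G| ≤ 9`, `blobLaw (G.map (k,·))` is heavy at `(ΣG/|G|, k·ΣG)`.  (An implication; nothing is assumed as a fact.)

HONEST STATUS.  The nine-equal-blobs statement is OPEN (hypothesis here); widths ≤ 8 are unconditional (`heavy_blobLaw_gates_width_le_eight`);
conjecture C, `SiblingStep`, `FarTreeRow`, `GluedLemmaW`, `GluedDominatedMass` OPEN; RATE class (log\*) / honest sentence of
`run/shared/lean/prim/quant/README.md` unchanged.  [this work].  Nothing here is cited as a published result.  The gluing rows served
[cite: KozmaNitzan2024, Conjecture 3 (p. 15)]; product measure [cite: Grimmett1999, §1.3 p. 10].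
-/



noncomputable section

open scoped BigOperators

namespace Summit.CriticalPhenomena.PercolationContinuityZ3.Theorems
namespace Quant

open Finset

/-- the two-point law `{lo, hi; g}` (as in `…QuantLawDEC`) -/
local notation3 "TP[" lo ", " hi ", " g ", " h "]" =>
  (g : ℝ) * (if (h : ℕ) = (hi : ℕ) then (1 : ℝ) else 0) + (1 - (g : ℝ)) * (if (h : ℕ) = (lo : ℕ) then (1 : ℝ) else 0)

/-- a HEAVY decomposition of the law `μ` on `{0..M}` at floor `x`, target `T` (the inline `∃` consumed by `decAtT_of_heavy`) -/
local notation3 "HEAVY[" x ", " T ", " M ", " μ "]" =>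
  ∃ (ι : Type) (_ : Fintype ι) (lam γ : ι → ℝ) (lo hi : ι → ℕ),
    (∀ i, 0 ≤ lam i) ∧ (∑ i, lam i = 1) ∧ (∀ i, 0 ≤ γ i ∧ γ i ≤ 1) ∧ (∀ i, lo i ≤ hi i) ∧ (∀ i, hi i ≤ (M : ℕ)) ∧
    (∀ h, (μ : ℕ → ℝ) h = ∑ i, lam i * TP[lo i, hi i, γ i, h]) ∧
    (∀ i, 0 < lam i → (x : ℝ) ≤ γ i ∧ (T : ℝ) ≤ 2 * (lo i : ℝ) + ((hi i : ℝ) - lo i) * γ i)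

/-- the blob list of a gate list at the common blob size `k` -/
local notation3 "BL[" k ", " G "]" => LawDec.blobLaw (List.map (fun g : ℝ => ((k : ℕ), g)) G)

namespace LawDec

/-- the equal-gates cells `m = 0`, `r ≤ 9`, `g < 1/2`, at any floor `x ≤ g` — MODULO the nine-equal-blobs statement. [this work] -/
theorem heavy_replicate_le_nine_floor_of (k r : ℕ) (hk : 0 < k)
    (H9 : ∀ g : ℝ, 0 < g → g < 1 → HEAVY[g, (9 : ℝ) * k * g, 9 * k, blobLaw (List.replicate 9 (k, g))])
    {g x : ℝ} (hg0 : 0 < g) (hg1 : g < 1 / 2) (hr : 0 < r) (hr9 : r ≤ 9)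
    (hx : x ≤ g) : HEAVY[x, (k : ℝ) * (r * g), r * k, blobLaw (List.replicate r (k, g))] := by
  rcases Nat.lt_or_ge r 9 with h8 | h9
  · exact heavy_replicate_le_eight_floor k r hk hg0 hg1 hr (by omega) hx
  · have hr9' : r = 9 := le_antisymm hr9 h9
    subst hr9'
    have key := H9 g hg0 (by linarith)
    rw [show (9 : ℝ) * k * g = (k : ℝ) * ((9 : ℕ) * g) by push_cast; ring] at key
    exact heavy_mono _ _ _ _ _ _ hx le_rfl key

/-- the cells `m ≥ 1`, `g < 1/2`, `m + r ≤ 9`, at any floor `x ≤ (m + r g)/(m + r)`, in shifted form — unconditional. [this work] -/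
theorem heavy_lowCells_le_nine_floor (k m r : ℕ) (hk : 0 < k) {g x : ℝ} (hg1 : g < 1 / 2) (hm : 0 < m) (hmr : m + r ≤ 9)
    (hlow : (m : ℝ) < r * g) (hx : x ≤ ((m : ℝ) + r * g) / ((m : ℝ) + r)) :
    HEAVY[x, (k : ℝ) * (r * g - m), r * k, blobLaw (List.replicate r (k, g))] := by
  have h2m : 2 * m < r := by
    have hr0 : (0 : ℝ) ≤ r := Nat.cast_nonneg r
    have : (2 * m : ℝ) < r := by nlinarith
    exact_mod_cast this
  rcases Nat.lt_or_ge (m + r) 9 with h8 | h9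
  · exact heavy_lowCells_le_eight_floor k m r hk hg1 hm (by omega) hlow hx
  have hcases : (m = 1 ∧ r = 8) ∨ (m = 2 ∧ r = 7) := by omega
  rcases hcases with ⟨rfl, rfl⟩ | ⟨rfl, rfl⟩ <;> push_cast at hlow hx ⊢
  · have hx' : x ≤ ((1 : ℝ) + 8 * g) / 9 := by norm_num at hx; linarith
    rcases le_or_gt g (5 / 32) with h1 | h1
    · exact heavy_mono _ _ _ _ _ _ hx' le_rfl (heavy_c18a k hk (by linarith) h1)
    rcases le_or_gt g (11 / 56) with h2 | h2
    · exact heavy_mono _ _ _ _ _ _ hx' le_rfl (heavy_c18b k hk h1 h2)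
    rcases le_or_gt g (1 / 4) with h3 | h3
    · exact heavy_mono _ _ _ _ _ _ hx' le_rfl (heavy_c18c k hk h2 h3)
    rcases le_or_gt g (13 / 40) with h4 | h4
    · exact heavy_mono _ _ _ _ _ _ hx' le_rfl (heavy_c18d k hk h3 h4)
    rcases le_or_gt g (3 / 8) with h5 | h5
    · exact heavy_mono _ _ _ _ _ _ hx' le_rfl (heavy_c18e k hk h4 h5)
    · exact heavy_mono _ _ _ _ _ _ hx' le_rfl (heavy_c18f k hk h5 hg1)
  · have hx' : x ≤ ((2 : ℝ) + 7 * g) / 9 := by norm_num at hx ⊢; linarith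
    exact heavy_mono _ _ _ _ _ _ hx' le_rfl (heavy_c27 k hk (by linarith) hg1)

/-- **WIDTH 9 MODULO NINE EQUAL BLOBS.**  If nine equal blobs `(k,g)` are heavy at their common gate for every `0 < g < 1`, then for every gate list
`G ⊂ [0,1]` with `|G| ≤ 9` and every `k ≥ 1`, `blobLaw (G.map (k,·))` is heavy at floor `ΣG/|G|` and target `k·ΣG`. [this work] -/
theorem heavy_blobLaw_gates_width_le_nine_of_nine (k : ℕ) (hk : 0 < k)
    (H9 : ∀ g : ℝ, 0 < g → g < 1 → HEAVY[g, (9 : ℝ) * k * g, 9 * k, blobLaw (List.replicate 9 (k, g))])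
    (G : List ℝ) (hG : ∀ g ∈ G, 0 ≤ g ∧ g ≤ 1) (hn : G.length ≤ 9) :
    HEAVY[G.sum / G.length, (k : ℝ) * G.sum, G.length * k, BL[k, G]] := by
  refine heavy_blobLaw_of_onesEqualFamily k G hG fun m r g hmr hg0 hg1 hS hlow => ?_
  have hr : 0 < r := by
    rcases Nat.eq_zero_or_pos r with h0 | h0
    · exfalso; subst h0
      simp only [Nat.cast_zero, zero_mul] at hlow
      linarith [Nat.cast_nonneg (α := ℝ) m]
    · exact h0
  have hr' : (0 : ℝ) < r := by exact_mod_cast hr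
  have hmr' : ((m : ℝ) + r) ≤ G.length := by exact_mod_cast hmr
  have hmrpos : (0 : ℝ) < (m : ℝ) + r := by positivity
  have hSnn : 0 ≤ (m : ℝ) + r * g := by positivity
  have hx : G.sum / G.length ≤ ((m : ℝ) + r * g) / ((m : ℝ) + r) := by
    rw [← hS]; exact div_le_div_of_nonneg_left hSnn hmrpos hmr'
  rcases le_or_gt (1 / 2 : ℝ) g with hhalf | hhalf
  · -- reflection cells
    have key := heavy_onesEqual_of_half_le_floor k m r hhalf hg1 hr hx
    rw [hS] at key
    exact key
  rcases Nat.eq_zero_or_pos m with hm0 | hmpos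
  · -- equal gates
    subst hm0
    simp only [Nat.cast_zero, zero_add] at hS hx
    have hxg : G.sum / G.length ≤ g := by rwa [mul_div_cancel_left₀ g hr'.ne'] at hx
    have key := heavy_replicate_le_nine_floor_of k r hk H9 hg0 hhalf hr (by omega) hxg
    rw [hS] at key
    simpa only [List.replicate_zero, List.nil_append, List.map_replicate, zero_add] using key
  · -- single-low cells, via the shifted form
    have hcell := heavy_lowCells_le_nine_floor k m r hk hhalf hmpos (hmr.trans hn) hlow hx
    have key := heavy_onesEqual_of_shifted k m r g _ hcell
    rw [hS] at key
    exact key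

end LawDec
end Quant
end Summit.CriticalPhenomena.PercolationContinuityZ3.Theorems
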